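/-
Origin: expansion seat `prover-pub-hodgecm-mc-carch-1-g4-0`, handover #CA37 2026-08-20T09:03Z md5 09732eef6f2d (315 l., 12 decls; NEW additive leaf; imports installed RUN-45 #CA36 Model.ArchKTypeOfSigma + installed Model.HypCensus.KappaEigen + Model.HypCensus.InsBlock; RUN 46; cert certs/ax-ArchKTypeOfSigmaIota-09732eef6f2d.log: rc 0 / 26 s / 0 warnings / 12/12 trio) (`HOME/mc/pub-hodgecm-mc-carch-1/pkg46/HodgeCM/Model/ArchKTypeOfSigmaIota.lean`, md5 09732eef6f2d, 315 lines);
landed by the second packager p2 gen 5 (p2-g5) in gate run 46 as `HodgeCM/Model/ArchKTypeOfSigmaIota.lean` (verbatim).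
-/
/-
Copyright (c) 2026. Released under Apache 2.0 license as described in the file LICENSE.
Cell pub-hodgecm, MODEL layer (construction prover mc-carch-1, gen 4), BINDER-OWNERS row 12 `C`, junction (C-Σ) at `v₁`:
the pin's letter character ON THE `ι₁`-LETTERS from the see-saw of the two line vacua.
-/
import Summits.HodgeConjecture.HodgeCM.Model.ArchKTypeOfSigma
import Summits.HodgeConjecture.HodgeCM.Model.HypCensus.KappaEigen
import Summits.HodgeConjecture.HodgeCM.Model.HypCensus.InsBlock

/-!
# (C-Σ) at `v₁`: the letter character of the pin on `U(V⁺_{v₁}) × U(V⁻_{v₁})` from the line data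

Binder-2 #74 `hκ₁_iff_letterChar` reduces (V-val) at the `ι₁` slot to the CLOSED FORM of
`pinLetterChar (kVLetters (mulSingle v₁ (A, D)))`.  The see-saw of the three chosen splittings on the slot box of the two LINE
VACUA (which is the pair's vacuum `follandFock 𝔢 1`) gives it from the lines:

* § 1 `cmArchWeilRep_line_archSingle_uOfLetter_follandFock_one`: the line pair `(U(V), U(⟨d⟩))` acts on its vacuum at the one-place
  element of a `v₁`-letter `(A, D)` by Konno–Konno's `vacScalar` of its exponent tuple of record at the relabelled letter (binder-2
  `cmArchWeilRep_κ_binvPi` at `G = 1`; the block section of the relabelled letter IS `(archSingle (uOfLetter v₁ (A, D)), 1)`);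
* § 2 `pinLetterChar_kVLetters_mulSingle_cmPlace_eq`: **`pinLetterChar (kVLetters (mulSingle v₁ x)) = Λ₀(u_x) · vacScalar e₀ (letterK x) ·
  vacScalar e₁ (letterK x)`**, `Λ₀ = defLambdaChar … v₁` the see-saw discrepancy `cmLineChar₀` at `((archSingle u_x)^𝔸, 1)` (K-1's
  see-saw identity at trivial twists on `φ(vac₀) ⊗″ φ(vac₁)`);
* the sibling leaf `ArchKTypeOfSigmaIotaVal` evaluates `Λ₀` at the exponent of record and lands (V-val) at the R1 pin.

0 records, 0 `def … : Prop`, nothing cited as a hypothesis.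
-/

set_option autoImplicit false

noncomputable section

open NumberField NumberField.InfinitePlace NumberField.mixedEmbedding IsDedekindDomain
open scoped Matrix Classical TensorProduct
open ComplexConjugate MvPolynomial
open Literature.NumberTheory.Automorphic Literature.NumberTheory.Automorphic.UnitaryGroup Literature.NumberTheory.Weil1964
open Literature.NumberTheory.GelbartRogawski1991 Literature.NumberTheory.GelbartRogawski1991.UnitaryDualPair
open Literature.RepresentationTheory.KonnoKonno2007 Literature.RepresentationTheory.KonnoKonno2007.RealDualPair
open Literature.RepresentationTheory (atPlace)
open Literature.Analysis.SegalBargmann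
open HodgeCM.Adelic HodgeCM.PerL34 HodgeCM.Model.HypCensus HodgeCM.Model.ArchSideTerm HodgeCM.Model.SupplyInstance

namespace HodgeCM.Model

/-! ## § 1 A line pair on its vacuum at the one-place element of a `v₁`-letter -/

section LineVacuum

variable {L : CMField} {ι₁ : L →+* ℂ} (V : HermSpace3 L ι₁) (S : StubTree.SeesawDatum L)
variable (d : (L : Type)) (hd : IsCMField.complexConj L d = d) (hd0 : d ≠ 0)
  (hGRd : (cmSplittingDatum (L : Type) (e₁) (frameD V) (frameD_real V) (frameD_ne V) (lineVec (L : Type) d) (fun _ => hd)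
    (fun _ => hd0)).CompatibleSplitting)
variable {R' S' : Type} [Fintype R'] [DecidableEq R'] [Fintype S'] [DecidableEq S']
  (eR : PosIdx (cmXW (L : Type) (frameD V) (lineVec (L : Type) d) (fun _ => hd) ι₁ (cmPlace (L : Type) ι₁)) ≃ R')
  (eS : NegIdx (cmXW (L : Type) (frameD V) (lineVec (L : Type) d) (fun _ => hd) ι₁ (cmPlace (L : Type) ι₁)) ≃ S')
variable
  (hsign : (∃ i₀ : Fin 3, (∀ i, i ≠ i₀ → 0 < (ι₁ (frameD V i)).re) ∨ ∀ i, i ≠ i₀ → (ι₁ (frameD V i)).re < 0) ∧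
    ((∀ j, 0 < (ι₁ (lineVec (L : Type) d j)).re) ∨ ∀ j, (ι₁ (lineVec (L : Type) d j)).re < 0) ∧
    (∀ τ : (L : Type) →+* ℂ, InfinitePlace.mk τ ≠ InfinitePlace.mk ι₁ →
      (∀ i, 0 < (τ (frameD V i)).re) ∨ ∀ i, (τ (frameD V i)).re < 0) ∧
    (∀ τ : (L : Type) →+* ℂ, InfinitePlace.mk τ ≠ InfinitePlace.mk ι₁ →
      (∃ j₀ : Fin 1, ∀ j, j ≠ j₀ → 0 < (τ (lineVec (L : Type) d j)).re) ∨ ∀ j, (τ (lineVec (L : Type) d j)).re < 0))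
  (hslot : ∃ ω₁ : Representation ℂ (Ginf (Fin 2) Unit R' S') (SchwartzMap (DPIdx (Fin 2) Unit R' S' → ℝ) ℂ),
    IsArchWeilDatum (ι𝕎 (Fin 2) Unit R' S') ω₁ ∧ ∀ u, Continuous (ω₁ u))

/-- **the relabelled letter**: a `v₁`-letter `(A, D) ∈ U(V⁺_{v₁}) × U(V⁻_{v₁})` read in a line's block labels `(Fin 2, Unit, R', S')`,
with trivial `W`-part. -/
def letterK (x : Matrix.unitaryGroup (PosIdx (cmXV (L : Type) (frameD V) (frameD_real V) ι₁ (cmPlace (L : Type) ι₁))) ℂ ×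
      Matrix.unitaryGroup (NegIdx (cmXV (L : Type) (frameD V) (frameD_real V) ι₁ (cmPlace (L : Type) ι₁))) ℂ) :
    DPK (Fin 2) Unit R' S' :=
  ((reindexUnitary (blockPosEquiv V).symm x.1, reindexUnitary (blockNegEquiv V).symm x.2), 1)

/-- `κ` of the relabelled letter is the relabelling of `κ (x, 1)`. -/
theorem κ_letterK (x : Matrix.unitaryGroup (PosIdx (cmXV (L : Type) (frameD V) (frameD_real V) ι₁ (cmPlace (L : Type) ι₁))) ℂ ×
      Matrix.unitaryGroup (NegIdx (cmXV (L : Type) (frameD V) (frameD_real V) ι₁ (cmPlace (L : Type) ι₁))) ℂ) :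
    κ (Fin 2) Unit R' S' (letterK V x) =
      Ginf.relabel (PosIdx (cmXV (L : Type) (frameD V) (frameD_real V) ι₁ (cmPlace (L : Type) ι₁)))
        (NegIdx (cmXV (L : Type) (frameD V) (frameD_real V) ι₁ (cmPlace (L : Type) ι₁)))
        (PosIdx (cmXW (L : Type) (frameD V) (lineVec (L : Type) d) (fun _ => hd) ι₁ (cmPlace (L : Type) ι₁)))
        (NegIdx (cmXW (L : Type) (frameD V) (lineVec (L : Type) d) (fun _ => hd) ι₁ (cmPlace (L : Type) ι₁))) (Fin 2) Unit R' S'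
        (blockPosEquiv V) (blockNegEquiv V) eR eS (κ _ _ _ _ (x, 1)) := by
  rw [Ginf.relabel_apply]
  have h1 : (κ (Fin 2) Unit R' S' (letterK V x)).1 =
      UForm.kV _ _ (reindexUnitary (blockPosEquiv V).symm x.1, reindexUnitary (blockNegEquiv V).symm x.2) := rfl
  have h2 : (κ (PosIdx (cmXV (L : Type) (frameD V) (frameD_real V) ι₁ (cmPlace (L : Type) ι₁)))
      (NegIdx (cmXV (L : Type) (frameD V) (frameD_real V) ι₁ (cmPlace (L : Type) ι₁)))
      (PosIdx (cmXW (L : Type) (frameD V) (lineVec (L : Type) d) (fun _ => hd) ι₁ (cmPlace (L : Type) ι₁)))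
      (NegIdx (cmXW (L : Type) (frameD V) (lineVec (L : Type) d) (fun _ => hd) ι₁ (cmPlace (L : Type) ι₁)))
      (x, 1)).1 = UForm.kV _ _ x := rfl
  have h3 : (κ (Fin 2) Unit R' S' (letterK V x)).2 = 1 := map_one (UForm.kV R' S')
  have h4 : (κ (PosIdx (cmXV (L : Type) (frameD V) (frameD_real V) ι₁ (cmPlace (L : Type) ι₁)))
      (NegIdx (cmXV (L : Type) (frameD V) (frameD_real V) ι₁ (cmPlace (L : Type) ι₁)))
      (PosIdx (cmXW (L : Type) (frameD V) (lineVec (L : Type) d) (fun _ => hd) ι₁ (cmPlace (L : Type) ι₁)))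
      (NegIdx (cmXW (L : Type) (frameD V) (lineVec (L : Type) d) (fun _ => hd) ι₁ (cmPlace (L : Type) ι₁)))
      (x, 1)).2 = 1 := map_one (UForm.kV _ _)
  refine Prod.ext ?_ ?_
  · rw [h1, h2]
    apply Subtype.ext; apply Units.ext
    rw [UForm.coe_relabel, UForm.coe_kV, UForm.coe_kV]
    ext (i | i) (j | j) <;> simp [Matrix.fromBlocks, reindexUnitary_apply]
  · rw [h3, h4, map_one]

/-- **the block section of the relabelled letter is the one-place element `(archSingle (uOfLetter v₁ x), 1)`** of binder-2's
`K_V`-letter `x` (the `V`-half of the inverse pair frame does not see `W`). -/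
theorem cmBlockSectionAt_κ_letterK
    (x : Matrix.unitaryGroup (PosIdx (cmXV (L : Type) (frameD V) (frameD_real V) ι₁ (cmPlace (L : Type) ι₁))) ℂ ×
      Matrix.unitaryGroup (NegIdx (cmXV (L : Type) (frameD V) (frameD_real V) ι₁ (cmPlace (L : Type) ι₁))) ℂ) :
    cmBlockSectionAt (L : Type) (frameD V) (frameD_real V) (frameD_ne V) (lineVec (L : Type) d) (fun _ => hd) (fun _ => hd0) ι₁
        (cmPlace (L : Type) ι₁) (blockPosEquiv V) (blockNegEquiv V) eR eS (κ (Fin 2) Unit R' S' (letterK V x)) =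
      (archSingle (↥(maximalRealSubfield L)) (L : Type) (IsCMField.complexConj L) 3 (Matrix.diagonal (frameD V))
          (IsCMField.complexConj_ne_one (L : Type)) (UnitaryGroup.complexConj_smul_infinitePlace (L : Type))
          (cmPlaceOver (L : Type) (cmPlace (L : Type) ι₁))
          (uOfLetter (L : Type) (frameD V) (frameD_real V) (frameD_ne V) (dW S) (dW_real S) (dW_ne S) ι₁ (cmPlace (L : Type) ι₁) x),
        1) := by
  rw [κ_letterK V d hd eR eS]
  have h := letterSectionAt_kV (L : Type) (frameD V) (frameD_real V) (frameD_ne V) (lineVec (L : Type) d) (fun _ => hd) (fun _ => hd0) ι₁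
    (cmPlace (L : Type) ι₁) x
  rw [letterSectionAt_apply] at h
  dsimp only [cmBlockSectionAt, MonoidHom.coe_comp, Function.comp_apply, MulEquiv.coe_toMonoidHom]
  erw [ContinuousMulEquiv.symm_apply_apply]
  exact h

/-- the vacuum of a line pair is its block-frame pull-back of `B⁻¹1 ⊠ B⁻¹1` at `v₁`. -/
theorem follandFock_one_eq_symm_tensorPi :
    follandFock (cmBigFrame (L : Type) e₁ (frameD V) (frameD_real V) (frameD_ne V) (lineVec (L : Type) d) (fun _ => hd) (fun _ => hd0) ι₁) 1 =
      (cmBlockFrameAt (L : Type) e₁ (frameD V) (frameD_real V) (frameD_ne V) (lineVec (L : Type) d) (fun _ => hd) (fun _ => hd0) ι₁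
          (cmPlace (L : Type) ι₁) (blockPosEquiv V) (blockNegEquiv V) eR eS).symm
        (tensorPi (binvPi 1) (binvPi 1)) := by
  have h := follandFock_prod_atPlace_eq_symm_tensorPi (L : Type) e₁ (frameD V) (frameD_real V) (frameD_ne V) (lineVec (L : Type) d)
    (fun _ => hd) (fun _ => hd0) ι₁ (cmPlace (L : Type) ι₁) (blockPosEquiv V) (blockNegEquiv V) eR eS (fun _ => 1)
  simp only [map_one, Finset.prod_const_one] at h
  exact h

/-- **a line pair acts on its vacuum at the one-place element of a `v₁`-letter by `vacScalar e (letterK x)`**, `e` its exponent tuple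
of record at `v₁` (binder-2 `placeVacExponents`). -/
theorem cmArchWeilRep_line_archSingle_uOfLetter_follandFock_one
    (x : Matrix.unitaryGroup (PosIdx (cmXV (L : Type) (frameD V) (frameD_real V) ι₁ (cmPlace (L : Type) ι₁))) ℂ ×
      Matrix.unitaryGroup (NegIdx (cmXV (L : Type) (frameD V) (frameD_real V) ι₁ (cmPlace (L : Type) ι₁))) ℂ) :
    cmArchWeilRep (L : Type) e₁ (frameD V) (frameD_real V) (frameD_ne V) (lineVec (L : Type) d) (fun _ => hd) (fun _ => hd0) hGRd
        (archSingle (↥(maximalRealSubfield L)) (L : Type) (IsCMField.complexConj L) 3 (Matrix.diagonal (frameD V))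
            (IsCMField.complexConj_ne_one (L : Type)) (UnitaryGroup.complexConj_smul_infinitePlace (L : Type))
            (cmPlaceOver (L : Type) (cmPlace (L : Type) ι₁))
            (uOfLetter (L : Type) (frameD V) (frameD_real V) (frameD_ne V) (dW S) (dW_real S) (dW_ne S) ι₁ (cmPlace (L : Type) ι₁) x),
          1)
        (follandFock (cmBigFrame (L : Type) e₁ (frameD V) (frameD_real V) (frameD_ne V) (lineVec (L : Type) d) (fun _ => hd)
          (fun _ => hd0) ι₁) 1) =
      vacScalar (placeVacExponents (L : Type) e₁ (frameD V) (frameD_real V) (frameD_ne V) (lineVec (L : Type) d) (fun _ => hd)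
          (fun _ => hd0) hGRd ι₁ (cmPlace (L : Type) ι₁) (blockPosEquiv V) (blockNegEquiv V) eR eS hsign hslot) (letterK V x : DPK (Fin 2) Unit R' S') •
        follandFock (cmBigFrame (L : Type) e₁ (frameD V) (frameD_real V) (frameD_ne V) (lineVec (L : Type) d) (fun _ => hd)
          (fun _ => hd0) ι₁) 1 := by
  rw [← cmBlockSectionAt_κ_letterK V S d hd hd0 eR eS x, follandFock_one_eq_symm_tensorPi V d hd hd0 eR eS,
    cmArchWeilRep_κ_binvPi (L : Type) e₁ (frameD V) (frameD_real V) (frameD_ne V) (lineVec (L : Type) d) (fun _ => hd) (fun _ => hd0)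
      hGRd ι₁ (cmPlace (L : Type) ι₁) (blockPosEquiv V) (blockNegEquiv V) eR eS hsign hslot, map_one]

/-- `vacScalar` at the relabelled letter: `det(A)^{2? no — |P'|=2: det A'^{e_P}}`: the scalar is `det A ^ e_P * det D ^ e_Q`. -/
theorem vacScalar_letterK (ev : VacExponents)
    (x : Matrix.unitaryGroup (PosIdx (cmXV (L : Type) (frameD V) (frameD_real V) ι₁ (cmPlace (L : Type) ι₁))) ℂ ×
      Matrix.unitaryGroup (NegIdx (cmXV (L : Type) (frameD V) (frameD_real V) ι₁ (cmPlace (L : Type) ι₁))) ℂ) :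
    vacScalar ev (letterK V x : DPK (Fin 2) Unit R' S') =
      ((x.1 : Matrix.unitaryGroup (PosIdx (cmXV (L : Type) (frameD V) (frameD_real V) ι₁ (cmPlace (L : Type) ι₁))) ℂ) : Matrix (PosIdx (cmXV (L : Type) (frameD V) (frameD_real V) ι₁ (cmPlace (L : Type) ι₁))) (PosIdx (cmXV (L : Type) (frameD V) (frameD_real V) ι₁ (cmPlace (L : Type) ι₁))) ℂ).det ^ ev.eP *
        ((x.2 : Matrix.unitaryGroup (NegIdx (cmXV (L : Type) (frameD V) (frameD_real V) ι₁ (cmPlace (L : Type) ι₁))) ℂ) : Matrix (NegIdx (cmXV (L : Type) (frameD V) (frameD_real V) ι₁ (cmPlace (L : Type) ι₁))) (NegIdx (cmXV (L : Type) (frameD V) (frameD_real V) ι₁ (cmPlace (L : Type) ι₁))) ℂ).det ^ ev.eQ := by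
  have h1 : ((reindexUnitary (blockPosEquiv V).symm x.1 : Matrix.unitaryGroup (Fin 2) ℂ) : Matrix (Fin 2) (Fin 2) ℂ).det =
      ((x.1 : Matrix.unitaryGroup (PosIdx (cmXV (L : Type) (frameD V) (frameD_real V) ι₁ (cmPlace (L : Type) ι₁))) ℂ) : Matrix (PosIdx (cmXV (L : Type) (frameD V) (frameD_real V) ι₁ (cmPlace (L : Type) ι₁))) (PosIdx (cmXV (L : Type) (frameD V) (frameD_real V) ι₁ (cmPlace (L : Type) ι₁))) ℂ).det := by
    rw [show ((reindexUnitary (blockPosEquiv V).symm x.1 : Matrix.unitaryGroup (Fin 2) ℂ) : Matrix (Fin 2) (Fin 2) ℂ) =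
      ((x.1 : Matrix.unitaryGroup (PosIdx (cmXV (L : Type) (frameD V) (frameD_real V) ι₁ (cmPlace (L : Type) ι₁))) ℂ) : Matrix (PosIdx (cmXV (L : Type) (frameD V) (frameD_real V) ι₁ (cmPlace (L : Type) ι₁))) (PosIdx (cmXV (L : Type) (frameD V) (frameD_real V) ι₁ (cmPlace (L : Type) ι₁))) ℂ).submatrix (blockPosEquiv V).symm (blockPosEquiv V).symm from rfl, Matrix.det_submatrix_equiv_self]
  have h2 : ((reindexUnitary (blockNegEquiv V).symm x.2 : Matrix.unitaryGroup Unit ℂ) : Matrix Unit Unit ℂ).det =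
      ((x.2 : Matrix.unitaryGroup (NegIdx (cmXV (L : Type) (frameD V) (frameD_real V) ι₁ (cmPlace (L : Type) ι₁))) ℂ) : Matrix (NegIdx (cmXV (L : Type) (frameD V) (frameD_real V) ι₁ (cmPlace (L : Type) ι₁))) (NegIdx (cmXV (L : Type) (frameD V) (frameD_real V) ι₁ (cmPlace (L : Type) ι₁))) ℂ).det := by
    rw [show ((reindexUnitary (blockNegEquiv V).symm x.2 : Matrix.unitaryGroup Unit ℂ) : Matrix Unit Unit ℂ) =
      ((x.2 : Matrix.unitaryGroup (NegIdx (cmXV (L : Type) (frameD V) (frameD_real V) ι₁ (cmPlace (L : Type) ι₁))) ℂ) : Matrix (NegIdx (cmXV (L : Type) (frameD V) (frameD_real V) ι₁ (cmPlace (L : Type) ι₁))) (NegIdx (cmXV (L : Type) (frameD V) (frameD_real V) ι₁ (cmPlace (L : Type) ι₁))) ℂ).submatrix (blockNegEquiv V).symm (blockNegEquiv V).symm from rfl, Matrix.det_submatrix_equiv_self]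
  simp only [vacScalar, letterK, h1, h2, Prod.fst_one, Prod.snd_one, OneMemClass.coe_one, Matrix.det_one, one_zpow, mul_one]

end LineVacuum

/-! ## § 2 The see-saw on the slot box of the two line vacua at a `v₁`-letter -/

section Iota

variable {L : CMField} {ι₁ : L →+* ℂ} (V : HermSpace3 L ι₁) (c : SeesawCtx L)
variable
  (hGR : (cmSplittingDatum (L : Type) finProdFinEquiv (frameD V) (frameD_real V) (frameD_ne V) (dW c.D) (dW_real c.D) (dW_ne c.D)).CompatibleSplitting)
  (hGR₀ : (cmSplittingDatum (L : Type) (e₁) (frameD V) (frameD_real V) (frameD_ne V) (lineVec (L : Type) (dW c.D 0))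
    (fun _ => dW_real c.D 0) (fun _ => dW_ne c.D 0)).CompatibleSplitting)
  (hGR₁ : (cmSplittingDatum (L : Type) (e₁) (frameD V) (frameD_real V) (frameD_ne V) (lineVec (L : Type) (dW c.D 1))
    (fun _ => dW_real c.D 1) (fun _ => dW_ne c.D 1)).CompatibleSplitting)
  (h₁W : (∀ j, 0 < (ι₁ (dW c.D j)).re) ∨ ∀ j, (ι₁ (dW c.D j)).re < 0)
  (hpos₀ : 0 < cmXW (L : Type) (frameD V) (lineVec (L : Type) (dW c.D 0)) (fun _ => dW_real c.D 0) ι₁ (HypCensus.cmPlace (L : Type) ι₁) 0)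
  (hpos₁ : 0 < cmXW (L : Type) (frameD V) (lineVec (L : Type) (dW c.D 1)) (fun _ => dW_real c.D 1) ι₁ (HypCensus.cmPlace (L : Type) ι₁) 0)

/-- line 0 on its vacuum at the one-place element of a `v₁`-letter: `vacScalar e₀ (letterK x)`. -/
theorem cmArchWeilRep_zero_archSingle_uOfLetter_follandFock_one (x : Matrix.unitaryGroup (PosIdx (cmXV (L : Type) (frameD V) (frameD_real V) ι₁ (cmPlace (L : Type) ι₁))) ℂ × Matrix.unitaryGroup (NegIdx (cmXV (L : Type) (frameD V) (frameD_real V) ι₁ (cmPlace (L : Type) ι₁))) ℂ) :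
    cmArchWeilRep (L : Type) e₁ (frameD V) (frameD_real V) (frameD_ne V) (lineVec (L : Type) (dW c.D 0)) (fun _ => dW_real c.D 0)
        (fun _ => dW_ne c.D 0) hGR₀
        ((UnitaryGroup.archSingle (↥(maximalRealSubfield L)) L (IsCMField.complexConj L) 3 (Matrix.diagonal (frameD V))
            (IsCMField.complexConj_ne_one L) (UnitaryGroup.complexConj_smul_infinitePlace (L : Type)) (cmPlaceOver (L : Type) (cmPlace (L : Type) ι₁))
            (uOfLetter (L : Type) (frameD V) (frameD_real V) (frameD_ne V) (dW c.D) (dW_real c.D) (dW_ne c.D) ι₁ (cmPlace (L : Type) ι₁) x)),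
          1)
        (follandFock (cmBigFrame (L : Type) e₁ (frameD V) (frameD_real V) (frameD_ne V) (lineVec (L : Type) (dW c.D 0)) (fun _ => dW_real c.D 0) (fun _ => dW_ne c.D 0) ι₁) 1) =
      vacScalar (lineVacExponentsZero V c hGR₀ h₁W (posIdxEquivUnit hpos₀) (negIdxEquivEmpty hpos₀)) (letterK V x : DPK (Fin 2) Unit Unit Empty) • (follandFock (cmBigFrame (L : Type) e₁ (frameD V) (frameD_real V) (frameD_ne V) (lineVec (L : Type) (dW c.D 0)) (fun _ => dW_real c.D 0) (fun _ => dW_ne c.D 0) ι₁) 1) :=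
  cmArchWeilRep_line_archSingle_uOfLetter_follandFock_one V c.D (dW c.D 0) (dW_real c.D 0) (dW_ne c.D 0) hGR₀ (posIdxEquivUnit hpos₀)
    (negIdxEquivEmpty hpos₀) (lineSign_zero V c h₁W) (exists_isArchWeilDatum_lineSlot (R := Unit) (S := Empty)) x

/-- line 1 on its vacuum at the one-place element of a `v₁`-letter: `vacScalar e₁ (letterK x)`. -/
theorem cmArchWeilRep_one_archSingle_uOfLetter_follandFock_one (x : Matrix.unitaryGroup (PosIdx (cmXV (L : Type) (frameD V) (frameD_real V) ι₁ (cmPlace (L : Type) ι₁))) ℂ × Matrix.unitaryGroup (NegIdx (cmXV (L : Type) (frameD V) (frameD_real V) ι₁ (cmPlace (L : Type) ι₁))) ℂ) :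
    cmArchWeilRep (L : Type) e₁ (frameD V) (frameD_real V) (frameD_ne V) (lineVec (L : Type) (dW c.D 1)) (fun _ => dW_real c.D 1)
        (fun _ => dW_ne c.D 1) hGR₁
        ((UnitaryGroup.archSingle (↥(maximalRealSubfield L)) L (IsCMField.complexConj L) 3 (Matrix.diagonal (frameD V))
            (IsCMField.complexConj_ne_one L) (UnitaryGroup.complexConj_smul_infinitePlace (L : Type)) (cmPlaceOver (L : Type) (cmPlace (L : Type) ι₁))
            (uOfLetter (L : Type) (frameD V) (frameD_real V) (frameD_ne V) (dW c.D) (dW_real c.D) (dW_ne c.D) ι₁ (cmPlace (L : Type) ι₁) x)),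
          1)
        (follandFock (cmBigFrame (L : Type) e₁ (frameD V) (frameD_real V) (frameD_ne V) (lineVec (L : Type) (dW c.D 1)) (fun _ => dW_real c.D 1) (fun _ => dW_ne c.D 1) ι₁) 1) =
      vacScalar (lineVacExponentsOne V c hGR₁ h₁W (posIdxEquivUnit hpos₁) (negIdxEquivEmpty hpos₁)) (letterK V x : DPK (Fin 2) Unit Unit Empty) • (follandFock (cmBigFrame (L : Type) e₁ (frameD V) (frameD_real V) (frameD_ne V) (lineVec (L : Type) (dW c.D 1)) (fun _ => dW_real c.D 1) (fun _ => dW_ne c.D 1) ι₁) 1) :=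
  cmArchWeilRep_line_archSingle_uOfLetter_follandFock_one V c.D (dW c.D 1) (dW_real c.D 1) (dW_ne c.D 1) hGR₁ (posIdxEquivUnit hpos₁)
    (negIdxEquivEmpty hpos₁) (lineSign_one V c h₁W) (exists_isArchWeilDatum_lineSlot (R := Unit) (S := Empty)) x

/-- line 0, twisted by the see-saw characters, at `((archSingle u_x)^𝔸, 1)` on the thin-coset test function of its vacuum:
the scalar `Λ₀(u_x) · vacScalar e₀ (letterK x)`. -/
theorem cmLineRepFin₀_one_archSingle_uOfLetter_testFun (x : Matrix.unitaryGroup (PosIdx (cmXV (L : Type) (frameD V) (frameD_real V) ι₁ (cmPlace (L : Type) ι₁))) ℂ × Matrix.unitaryGroup (NegIdx (cmXV (L : Type) (frameD V) (frameD_real V) ι₁ (cmPlace (L : Type) ι₁))) ℂ) (x₀ : Fin 3 → ↥(maximalRealSubfield L)) (N : ℕ) :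
    cmLineRepFin₀ (L : Type) finProdFinEquiv e₁ (frameD V) (frameD_real V) (frameD_ne V) (dW c.D) (dW_real c.D) (dW_ne c.D) hGR hGR₀ hGR₁ 1
        (UnitaryGroup.archToAdelic (↥(maximalRealSubfield L)) L (IsCMField.complexConj L) 3 (Matrix.diagonal (frameD V))
          (UnitaryGroup.archSingle (↥(maximalRealSubfield L)) L (IsCMField.complexConj L) 3 (Matrix.diagonal (frameD V))
            (IsCMField.complexConj_ne_one L) (UnitaryGroup.complexConj_smul_infinitePlace (L : Type)) (cmPlaceOver (L : Type) (cmPlace (L : Type) ι₁))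
            (uOfLetter (L : Type) (frameD V) (frameD_real V) (frameD_ne V) (dW c.D) (dW_real c.D) (dW_ne c.D) ι₁ (cmPlace (L : Type) ι₁) x)), 1)
        (testFun (↥(maximalRealSubfield L)) (Fin 3) (follandFock (cmBigFrame (L : Type) e₁ (frameD V) (frameD_real V) (frameD_ne V) (lineVec (L : Type) (dW c.D 0)) (fun _ => dW_real c.D 0) (fun _ => dW_ne c.D 0) ι₁) 1) x₀ N) =
      (((defLambdaChar V c.D hGR hGR₀ hGR₁ (cmPlace (L : Type) ι₁) (uOfLetter (L : Type) (frameD V) (frameD_real V) (frameD_ne V) (dW c.D) (dW_real c.D) (dW_ne c.D) ι₁ (cmPlace (L : Type) ι₁) x) : ℂˣ) : ℂ) *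
          vacScalar (lineVacExponentsZero V c hGR₀ h₁W (posIdxEquivUnit hpos₀) (negIdxEquivEmpty hpos₀)) (letterK V x : DPK (Fin 2) Unit Unit Empty)) •
        testFun (↥(maximalRealSubfield L)) (Fin 3) (follandFock (cmBigFrame (L : Type) e₁ (frameD V) (frameD_real V) (frameD_ne V) (lineVec (L : Type) (dW c.D 0)) (fun _ => dW_real c.D 0) (fun _ => dW_ne c.D 0) ι₁) 1) x₀ N := by
  have key := cmPairRep_archToAdelic_eq_adelicTensorEnd (L : Type) e₁ (frameD V) (frameD_real V) (frameD_ne V)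
    (lineVec (L : Type) (dW c.D 0)) (fun _ => dW_real c.D 0) (fun _ => dW_ne c.D 0) hGR₀
    (UnitaryGroup.archSingle (↥(maximalRealSubfield L)) L (IsCMField.complexConj L) 3 (Matrix.diagonal (frameD V))
            (IsCMField.complexConj_ne_one L) (UnitaryGroup.complexConj_smul_infinitePlace (L : Type)) (cmPlaceOver (L : Type) (cmPlace (L : Type) ι₁))
            (uOfLetter (L : Type) (frameD V) (frameD_real V) (frameD_ne V) (dW c.D) (dW_real c.D) (dW_ne c.D) ι₁ (cmPlace (L : Type) ι₁) x)) 1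
  rw [map_one] at key
  have key2 := apply_testFun_of_eq_adelicTensorEnd key (follandFock (cmBigFrame (L : Type) e₁ (frameD V) (frameD_real V) (frameD_ne V) (lineVec (L : Type) (dW c.D 0)) (fun _ => dW_real c.D 0) (fun _ => dW_ne c.D 0) ι₁) 1) x₀ N
  rw [cmArchWeilRep_zero_archSingle_uOfLetter_follandFock_one V c hGR₀ h₁W hpos₀, testFun_smul] at key2
  rw [cmLineRepFin₀_apply_eq_smul_cmPairRep, map_one, map_one, MonoidHom.one_apply, one_mul, ← defLambdaChar_apply]
  erw [key2]
  rw [smul_smul]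

/-- line 1 at `((archSingle u_x)^𝔸, 1)` on the thin-coset test function of its vacuum: the scalar `vacScalar e₁ (letterK x)`. -/
theorem cmLineRepFin₁_one_archSingle_uOfLetter_testFun (x : Matrix.unitaryGroup (PosIdx (cmXV (L : Type) (frameD V) (frameD_real V) ι₁ (cmPlace (L : Type) ι₁))) ℂ × Matrix.unitaryGroup (NegIdx (cmXV (L : Type) (frameD V) (frameD_real V) ι₁ (cmPlace (L : Type) ι₁))) ℂ) (x₁ : Fin 3 → ↥(maximalRealSubfield L)) (N : ℕ) :
    cmLineRepFin₁ (L : Type) finProdFinEquiv e₁ (frameD V) (frameD_real V) (frameD_ne V) (dW c.D) (dW_real c.D) (dW_ne c.D) hGR hGR₀ hGR₁ 1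
        (UnitaryGroup.archToAdelic (↥(maximalRealSubfield L)) L (IsCMField.complexConj L) 3 (Matrix.diagonal (frameD V))
          (UnitaryGroup.archSingle (↥(maximalRealSubfield L)) L (IsCMField.complexConj L) 3 (Matrix.diagonal (frameD V))
            (IsCMField.complexConj_ne_one L) (UnitaryGroup.complexConj_smul_infinitePlace (L : Type)) (cmPlaceOver (L : Type) (cmPlace (L : Type) ι₁))
            (uOfLetter (L : Type) (frameD V) (frameD_real V) (frameD_ne V) (dW c.D) (dW_real c.D) (dW_ne c.D) ι₁ (cmPlace (L : Type) ι₁) x)), 1)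
        (testFun (↥(maximalRealSubfield L)) (Fin 3) (follandFock (cmBigFrame (L : Type) e₁ (frameD V) (frameD_real V) (frameD_ne V) (lineVec (L : Type) (dW c.D 1)) (fun _ => dW_real c.D 1) (fun _ => dW_ne c.D 1) ι₁) 1) x₁ N) =
      vacScalar (lineVacExponentsOne V c hGR₁ h₁W (posIdxEquivUnit hpos₁) (negIdxEquivEmpty hpos₁)) (letterK V x : DPK (Fin 2) Unit Unit Empty) •
        testFun (↥(maximalRealSubfield L)) (Fin 3) (follandFock (cmBigFrame (L : Type) e₁ (frameD V) (frameD_real V) (frameD_ne V) (lineVec (L : Type) (dW c.D 1)) (fun _ => dW_real c.D 1) (fun _ => dW_ne c.D 1) ι₁) 1) x₁ N := by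
  have key := cmPairRep_archToAdelic_eq_adelicTensorEnd (L : Type) e₁ (frameD V) (frameD_real V) (frameD_ne V)
    (lineVec (L : Type) (dW c.D 1)) (fun _ => dW_real c.D 1) (fun _ => dW_ne c.D 1) hGR₁
    (UnitaryGroup.archSingle (↥(maximalRealSubfield L)) L (IsCMField.complexConj L) 3 (Matrix.diagonal (frameD V))
            (IsCMField.complexConj_ne_one L) (UnitaryGroup.complexConj_smul_infinitePlace (L : Type)) (cmPlaceOver (L : Type) (cmPlace (L : Type) ι₁))
            (uOfLetter (L : Type) (frameD V) (frameD_real V) (frameD_ne V) (dW c.D) (dW_real c.D) (dW_ne c.D) ι₁ (cmPlace (L : Type) ι₁) x)) 1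
  rw [map_one] at key
  have key2 := apply_testFun_of_eq_adelicTensorEnd key (follandFock (cmBigFrame (L : Type) e₁ (frameD V) (frameD_real V) (frameD_ne V) (lineVec (L : Type) (dW c.D 1)) (fun _ => dW_real c.D 1) (fun _ => dW_ne c.D 1) ι₁) 1) x₁ N
  rw [cmArchWeilRep_one_archSingle_uOfLetter_follandFock_one V c hGR₁ h₁W hpos₁, testFun_smul] at key2
  rw [cmLineRepFin₁_apply_eq_smul_cmPairRep, map_one, map_one, MonoidHom.one_apply, one_mul, cmLineChar₁_apply_mk_one, Units.val_one,
    one_smul]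
  erw [key2]

/-- the slot box of the two line vacua is the pair's vacuum. -/
theorem slotArchBox_follandFock_one :
    slotArchBox (follandFock (cmBigFrame (L : Type) e₁ (frameD V) (frameD_real V) (frameD_ne V) (lineVec (L : Type) (dW c.D 0)) (fun _ => dW_real c.D 0) (fun _ => dW_ne c.D 0) ι₁) 1) (follandFock (cmBigFrame (L : Type) e₁ (frameD V) (frameD_real V) (frameD_ne V) (lineVec (L : Type) (dW c.D 1)) (fun _ => dW_real c.D 1) (fun _ => dW_ne c.D 1) ι₁) 1) =
      follandFock (cmBigFrame (L : Type) finProdFinEquiv (frameD V) (frameD_real V) (frameD_ne V) (dW c.D) (dW_real c.D) (dW_ne c.D) ι₁) 1 := by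
  rw [slotArchBox_follandFock]
  simp only [map_one, mul_one]

/-- **(C-Σ) AT `v₁`, RAW FORM: the pin's letter character on a `v₁`-letter from the see-saw of the two line vacua** —
`pinLetterChar (kVLetters (mulSingle v₁ x)) = Λ₀(u_x) · vacScalar e₀ (letterK x) · vacScalar e₁ (letterK x)`, `Λ₀ = defLambdaChar … v₁`
the see-saw discrepancy of line 0 at `v₁`, `e₀, e₁` the lines' exponent tuples of record at `v₁`. -/
theorem pinLetterChar_kVLetters_mulSingle_cmPlace_eq (x : Matrix.unitaryGroup (PosIdx (cmXV (L : Type) (frameD V) (frameD_real V) ι₁ (cmPlace (L : Type) ι₁))) ℂ × Matrix.unitaryGroup (NegIdx (cmXV (L : Type) (frameD V) (frameD_real V) ι₁ (cmPlace (L : Type) ι₁))) ℂ) :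
    ((pinLetterChar V c.D hGR h₁W (kVLetters V c.D (Pi.mulSingle (cmPlace (L : Type) ι₁) x)) : Circle) : ℂ) =
      ((defLambdaChar V c.D hGR hGR₀ hGR₁ (cmPlace (L : Type) ι₁) (uOfLetter (L : Type) (frameD V) (frameD_real V) (frameD_ne V) (dW c.D) (dW_real c.D) (dW_ne c.D) ι₁ (cmPlace (L : Type) ι₁) x) : ℂˣ) : ℂ) *
        vacScalar (lineVacExponentsZero V c hGR₀ h₁W (posIdxEquivUnit hpos₀) (negIdxEquivEmpty hpos₀)) (letterK V x : DPK (Fin 2) Unit Unit Empty) *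
        vacScalar (lineVacExponentsOne V c hGR₁ h₁W (posIdxEquivUnit hpos₁) (negIdxEquivEmpty hpos₁)) (letterK V x : DPK (Fin 2) Unit Unit Empty) := by
  -- rational points where the two vacua do not vanish, and the (non-zero) see-saw tensor
  obtain ⟨x₀, hx₀⟩ := exists_apply_archEmb_ne_zero (↥(maximalRealSubfield L)) (Fin 3) (follandFock (cmBigFrame (L : Type) e₁ (frameD V) (frameD_real V) (frameD_ne V) (lineVec (L : Type) (dW c.D 0)) (fun _ => dW_real c.D 0) (fun _ => dW_ne c.D 0) ι₁) 1) (follandFock_one_ne_zero _)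
  obtain ⟨x₁, hx₁⟩ := exists_apply_archEmb_ne_zero (↥(maximalRealSubfield L)) (Fin 3) (follandFock (cmBigFrame (L : Type) e₁ (frameD V) (frameD_real V) (frameD_ne V) (lineVec (L : Type) (dW c.D 1)) (fun _ => dW_real c.D 1) (fun _ => dW_ne c.D 1) ι₁) 1) (follandFock_one_ne_zero _)
  have hφ₀ : testFun (↥(maximalRealSubfield L)) (Fin 3) (follandFock (cmBigFrame (L : Type) e₁ (frameD V) (frameD_real V) (frameD_ne V) (lineVec (L : Type) (dW c.D 0)) (fun _ => dW_real c.D 0) (fun _ => dW_ne c.D 0) ι₁) 1) x₀ 1 ≠ 0 := testFun_ne_zero _ hx₀ one_ne_zero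
  have hφ₁ : testFun (↥(maximalRealSubfield L)) (Fin 3) (follandFock (cmBigFrame (L : Type) e₁ (frameD V) (frameD_real V) (frameD_ne V) (lineVec (L : Type) (dW c.D 1)) (fun _ => dW_real c.D 1) (fun _ => dW_ne c.D 1) ι₁) 1) x₁ 1 ≠ 0 := testFun_ne_zero _ hx₁ one_ne_zero
  have hX := cmLineTensorFin_ne_zero V c.D hφ₀ hφ₁
  -- the see-saw restriction at `((archSingle u_x)^𝔸, diag(1,1))`, trivial twists
  have hss := cmPairRepTwist_torusIdeles_cmLineTensorFin (L : Type) finProdFinEquiv e₁ (frameD V) (frameD_real V) (frameD_ne V) (dW c.D)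
    (dW_real c.D) (dW_ne c.D) hGR hGR₀ hGR₁ 1 1 1 (fun _ _ _ => by rw [MonoidHom.one_apply, MonoidHom.one_apply, MonoidHom.one_apply, one_mul])
    (UnitaryGroup.archToAdelic (↥(maximalRealSubfield L)) L (IsCMField.complexConj L) 3 (Matrix.diagonal (frameD V))
      (UnitaryGroup.archSingle (↥(maximalRealSubfield L)) L (IsCMField.complexConj L) 3 (Matrix.diagonal (frameD V))
            (IsCMField.complexConj_ne_one L) (UnitaryGroup.complexConj_smul_infinitePlace (L : Type)) (cmPlaceOver (L : Type) (cmPlace (L : Type) ι₁))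
            (uOfLetter (L : Type) (frameD V) (frameD_real V) (frameD_ne V) (dW c.D) (dW_real c.D) (dW_ne c.D) ι₁ (cmPlace (L : Type) ι₁) x))) 1 1
    (testFun (↥(maximalRealSubfield L)) (Fin 3) (follandFock (cmBigFrame (L : Type) e₁ (frameD V) (frameD_real V) (frameD_ne V) (lineVec (L : Type) (dW c.D 0)) (fun _ => dW_real c.D 0) (fun _ => dW_ne c.D 0) ι₁) 1) x₀ 1) (testFun (↥(maximalRealSubfield L)) (Fin 3) (follandFock (cmBigFrame (L : Type) e₁ (frameD V) (frameD_real V) (frameD_ne V) (lineVec (L : Type) (dW c.D 1)) (fun _ => dW_real c.D 1) (fun _ => dW_ne c.D 1) ι₁) 1) x₁ 1)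
  have h11 : cmPlaneTorusIdeles (L : Type) (dW c.D) (1, 1) = 1 := map_one _
  rw [cmPairRepTwist_apply_eq_smul, MonoidHom.one_apply, Units.val_one, one_smul, h11,
    cmLineRepFin₀_one_archSingle_uOfLetter_testFun V c hGR hGR₀ hGR₁ h₁W hpos₀ (x := x) x₀ 1,
    cmLineRepFin₁_one_archSingle_uOfLetter_testFun V c hGR hGR₀ hGR₁ h₁W hpos₁ (x := x) x₁ 1, LinearMap.map_smul₂, LinearMap.map_smul, smul_smul] at hss
  -- the big side on the same vector: the pair's vacuum, pinned by `pinLetterChar`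
  obtain ⟨f, hXf⟩ := exists_cmLineTensorFin_testFun_eq_tmul V c.D (follandFock (cmBigFrame (L : Type) e₁ (frameD V) (frameD_real V) (frameD_ne V) (lineVec (L : Type) (dW c.D 0)) (fun _ => dW_real c.D 0) (fun _ => dW_ne c.D 0) ι₁) 1) (follandFock (cmBigFrame (L : Type) e₁ (frameD V) (frameD_real V) (frameD_ne V) (lineVec (L : Type) (dW c.D 1)) (fun _ => dW_real c.D 1) (fun _ => dW_ne c.D 1) ι₁) 1) x₀ x₁ 1
  have key := cmPairRep_archToAdelic_eq_adelicTensorEnd (L : Type) finProdFinEquiv (frameD V) (frameD_real V) (frameD_ne V) (dW c.D)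
    (dW_real c.D) (dW_ne c.D) hGR
    (UnitaryGroup.archSingle (↥(maximalRealSubfield L)) L (IsCMField.complexConj L) 3 (Matrix.diagonal (frameD V))
            (IsCMField.complexConj_ne_one L) (UnitaryGroup.complexConj_smul_infinitePlace (L : Type)) (cmPlaceOver (L : Type) (cmPlace (L : Type) ι₁))
            (uOfLetter (L : Type) (frameD V) (frameD_real V) (frameD_ne V) (dW c.D) (dW_real c.D) (dW_ne c.D) ι₁ (cmPlace (L : Type) ι₁) x)) 1
  rw [map_one] at key
  have hbig := LinearMap.congr_fun key
    (cmLineTensorFin (L : Type) finProdFinEquiv e₁ (frameD V) (frameD_real V) (frameD_ne V) (dW c.D) (dW_real c.D) (dW_ne c.D)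
      (testFun (↥(maximalRealSubfield L)) (Fin 3) (follandFock (cmBigFrame (L : Type) e₁ (frameD V) (frameD_real V) (frameD_ne V) (lineVec (L : Type) (dW c.D 0)) (fun _ => dW_real c.D 0) (fun _ => dW_ne c.D 0) ι₁) 1) x₀ 1) (testFun (↥(maximalRealSubfield L)) (Fin 3) (follandFock (cmBigFrame (L : Type) e₁ (frameD V) (frameD_real V) (frameD_ne V) (lineVec (L : Type) (dW c.D 1)) (fun _ => dW_real c.D 1) (fun _ => dW_ne c.D 1) ι₁) 1) x₁ 1))
  rw [hXf, adelicTensorEnd_apply_tmul, LinearMap.id_apply, slotArchBox_follandFock_one V c,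
    cmArchWeilRep_archSingle_uOfLetter_follandFock_one V c.D hGR h₁W (cmPlace (L : Type) ι₁) x, ← TensorProduct.smul_tmul', map_smul,
    ← slotArchBox_follandFock_one V c, ← hXf] at hbig
  -- compare
  erw [hbig] at hss
  exact smul_left_injective ℂ hX hss

end Iota

end HodgeCM.Model

end
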